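/-
Copyright (c) 2026 the pub-hodgecm-mathlib formalisation cell (harness21).  Prover seat hodgecm-mathlib-F0P3a-p04 (g16), 2026-09-01.  Road «S3-tree» (architect A-p16 (g29)),
brick T3′ «depth-zero κ-transfer» (holder F0P3b-p01 (g11)), population (P-3) LEVI: organ O8d-alg³ — the Levi twin of ★ `DepthZeroTransferMatrixIdentity` (O8d-alg) and ★
`DepthZeroTransferMatrixIdentityTypeTwo` (O8d-alg²).
-/
import Mathlib.Tactic
import HarnessLib

/-!
# The depth-zero `2×3` matrix (L4) on the LEVI population: the Heisenberg rank strata `(1, q−1, q³−q)` of `N(𝔽_q)` map to the line strata `(1, q−1)` of `N_H(𝔽_q)`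

Topic `NumberTheory/Rogawski1990`; namespace `Literature.NumberTheory.Rogawski1990.Flicker1998`.  THEOREMS ONLY (no definition, no instance, no notation, no named fact, no `sorry`);
pure `ℚ`-algebra, Mathlib-only.  Cell `pub/hodgecm-mathlib`, crux H413 = `stmt-HodgeConjecture-24833`; road «S3-tree», brick T3′ (HEAD v4 clause `depthZeroKappaTransfer_hyperspecial_levi`,
DESIGN v2 §2 (P-3); census `F0/P3a/F0P3a-p04/g16/CENSUS-T3prime-P3.F0P3a-p04g16.md`).  HONEST LABEL: HC_CM is proved only modulo the cell's 2 remaining named inputs (hLiu418 24832,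
h413 24833) until rung 0 closes; this file is elementary algebra and asserts nothing printed.

THE MATHEMATICS.  On the LEVI population (deep `G`-regular `γ_H = (g, u)` with `g` split over `L_w`, torus `E^× × E¹`, NON-compact centraliser) both sides of (4.3.1) have ONE
class (★ `StableClassesSplitTorus`, ★ `LocalDeltaTransferLeviStratum`: `Σᶠ_c Δ‴·Φ(c, f) = Δ‴(γ_H, γ₀)·Φ(⟦γ₀⟧, f)`, `Δ‴ = ‖d₀⁻¹u − 1‖` ★ `FinExplicitTransferFactorLeviStratum`),
and the orbital integrals DESCEND to the unipotent radicals (★ `TorusOrbitalDescentCanonical`: `O_t(φ) = (ν(K)∕(κ(K)·μ_N(N ∩ K)))·J(t)·∫_{K×N} φ(k(tn)k⁻¹)`).  For a depth-zero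
piece `g` (Ad `K`-invariant, value `c_r` on the residually-unipotent Jordan stratum `r` of `K`) and `γ₀ = t ∈ T(𝒪_v)` DEEP (`t ≡ 1 mod ϖ`), `rank(red(t n) − 1) = rank(red n − 1)`
on `N(𝒪_v)`, so `∫_N g(tn) dn = μ_N(N(𝒪))·q⁻³·(c₀·1 + c₁·(q−1) + c₂·(q³−q))` — the RANK STRATA of the finite Heisenberg group `N(𝔽_q) = {n(x, z) : x ∈ 𝔽_{q²}, z + z̄ = −x x̄}`
of order `q³`: `n − 1 = [[0,x,z],[0,0,−x̄],[0,0,0]]` has rank `0` iff `x = z = 0` (ONE element), rank `1` iff `x = 0 ≠ z` (`q − 1`), rank `2` iff `x ≠ 0` (`q³ − q`); on `H` the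
unipotent radical of `U(1,1)` is the `𝔽_q`-line `{n(y) : y + ȳ = 0}` of order `q`: rank `0` once, rank `1` on `q − 1` elements.  With the unit clause (★ `UnitFundamentalLemmaInertLevi`:
`Δ‴·ν(K)J_G(t) = ν_H(K_H)J_H(γ_H)`, the `c ≡ 1` case) the P-3 clause is EXACTLY the finite identity proved here, with the SAME matrix `M = [[q⁻², 0], [(q²−1)∕q², −1∕q], [0, (q+1)∕q]]`
as types (1) and (2):
  `q⁻³·(c₀·1 + c₁·(q−1) + c₂·(q³−q)) = q⁻¹·((q⁻²c₀ + ((q²−1)∕q²)c₁)·1 + (−q⁻¹c₁ + ((q+1)∕q)c₂)·(q−1))`.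

* `heisenberg_rankStrata_sum` (`1 + (q−1) + (q³−q) = q³`), `line_rankStrata_sum` (`1 + (q−1) = q`),
* **`depthZero_matrix_identity_levi`** (arbitrary `c`), **`depthZero_matrix_identity_levi_rows`** (the three rows `c = e₀, e₁, e₂`: `q⁻³ = q⁻²·q⁻¹`,
  `q⁻³(q−1) = ((q²−1)∕q²)q⁻¹ − q⁻¹·(q−1)∕q`, `q⁻³(q³−q) = ((q+1)∕q)·(q−1)∕q`).

## References
* [Rogawski1990] J. D. Rogawski, *Automorphic Representations of Unitary Groups in Three Variables* (1990), §4.9 Prop. 4.9.1 (a)(b), (4.9.2) p. 55 (Levi case: `Φ(γ, 1_K) =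
  |D(γ)|⁻¹(1_K)^{(B)}(γ)`); §4.13 Lemma 4.13.1 (a) p. 64; §8.1 Prop. 8.1.1 p. 112.
* [Flicker1998UnitaryFL] Y. Z. Flicker, *Elementary proof of the fundamental lemma for a unitary group*, Canad. J. Math. 50 (1998), §2 (the Heisenberg group `N`), §6.
-/

set_option autoImplicit false

namespace Literature.NumberTheory.Rogawski1990.Flicker1998

/-- The three rank strata of the finite Heisenberg group exhaust it: `1 + (q − 1) + (q³ − q) = q³`. [cite: Flicker1998UnitaryFL, §2] -/
theorem heisenberg_rankStrata_sum (q : ℕ) : (1 : ℚ) + ((q : ℚ) - 1) + ((q : ℚ) ^ 3 - q) = (q : ℚ) ^ 3 := by ring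

/-- The two rank strata of the line exhaust it: `1 + (q − 1) = q`. [cite: Flicker1998UnitaryFL, §2] -/
theorem line_rankStrata_sum (q : ℕ) : (1 : ℚ) + ((q : ℚ) - 1) = (q : ℚ) := by ring

/-- **THE DEPTH-ZERO MATRIX IDENTITY, LEVI POPULATION** (see the module docstring): the normalised Heisenberg rank distribution `q⁻³·(c₀ + c₁(q−1) + c₂(q³−q))` of a
depth-zero piece equals the `M`-image of the normalised line distribution, for arbitrary stratum values `c₀ c₁ c₂`, `q > 1`.
[cite: Rogawski1990, §4.9 Prop. 4.9.1 (a) p. 55; (4.9.2) p. 55; §8.1 Prop. 8.1.1 p. 112] [cite: Flicker1998UnitaryFL, §2] -/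
theorem depthZero_matrix_identity_levi {q : ℕ} (hq : 1 < q) (c₀ c₁ c₂ : ℚ) :
    ((q : ℚ) ^ 3)⁻¹ * (c₀ * 1 + c₁ * ((q : ℚ) - 1) + c₂ * ((q : ℚ) ^ 3 - q)) =
      ((q : ℚ))⁻¹ * ((((q : ℚ) ^ 2)⁻¹ * c₀ + (((q : ℚ) ^ 2 - 1) / (q : ℚ) ^ 2) * c₁) * 1 +
        (-((q : ℚ))⁻¹ * c₁ + (((q : ℚ) + 1) / (q : ℚ)) * c₂) * ((q : ℚ) - 1)) := by
  have hq0 : (q : ℚ) ≠ 0 := Nat.cast_ne_zero.2 (by omega)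
  field_simp
  ring

/-- **THE THREE ROWS, LEVI POPULATION** (the identity at `c = e₀, e₁, e₂`): `q⁻³·1 = q⁻¹·(q⁻²·1)`, `q⁻³·(q−1) = q⁻¹·(((q²−1)∕q²)·1 − q⁻¹·(q−1))`,
`q⁻³·(q³−q) = q⁻¹·(((q+1)∕q)·(q−1))`. [cite: Rogawski1990, §4.9 Prop. 4.9.1 (a) p. 55] [cite: Flicker1998UnitaryFL, §2] -/
theorem depthZero_matrix_identity_levi_rows {q : ℕ} (hq : 1 < q) :
    ((q : ℚ) ^ 3)⁻¹ * 1 = ((q : ℚ))⁻¹ * (((q : ℚ) ^ 2)⁻¹ * 1) ∧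
      ((q : ℚ) ^ 3)⁻¹ * ((q : ℚ) - 1) = ((q : ℚ))⁻¹ * ((((q : ℚ) ^ 2 - 1) / (q : ℚ) ^ 2) * 1 - ((q : ℚ))⁻¹ * ((q : ℚ) - 1)) ∧
      ((q : ℚ) ^ 3)⁻¹ * ((q : ℚ) ^ 3 - q) = ((q : ℚ))⁻¹ * ((((q : ℚ) + 1) / (q : ℚ)) * ((q : ℚ) - 1)) := by
  have r0 := depthZero_matrix_identity_levi hq 1 0 0
  have r1 := depthZero_matrix_identity_levi hq 0 1 0
  have r2 := depthZero_matrix_identity_levi hq 0 0 1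
  simp only [one_mul, zero_mul, mul_one, mul_zero, add_zero, zero_add] at r0 r1 r2
  refine ⟨?_, ?_, ?_⟩
  · rw [r0]; ring
  · rw [r1]; ring
  · rw [r2]

end Literature.NumberTheory.Rogawski1990.Flicker1998
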